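import Summits.ResolutionOfSingularities.ResolutionOfSingularities.Theorems.DeltaCutRefCertificates
import HarnessLib

/-!
# DeltaCutRefCertificates2 — decomp-res node «RefCut (certificates)» (lens-6 g27, critic row 204 CLEARED (F-curve
WHOLE) DECIDED +1 · MAP 0), tree file 2/5 of the node

Content VERBATIM from the decomp-res lens-6 g27 certificate file
`HOME/decomp-res-lens-6/g27/RefCutCertificates.lean` (pin 745ed495; ring level, imports the landed
`DeltaCutSepCertificates5`; namespace `…Theorems.DeltaCutClasses`, section `RefCertificates`); HOME =
run/shared/lean/pub/decomp-res; critic CRITIC-LEDGER row 204 CLEARED (F-curve WHOLE) DECIDED +1 · MAP 0; landing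
orders NEXT-g28.md §4 (F) + INBOX :1315 — provenance, critic text and the lens header in full in the first
certificate file `DeltaCutRefCertificates`.  `--kind proof --supports stmt-ResolutionOfSingularities-26971`.

## This file

Continuation 2/5 of `DeltaCutRefCertificates` (same namespace / sections of the node, cut at the tree's 400-line
cap; section variables / opens replayed): scopes `RefCertificates` — carries `Cx_A_chart_u_top`,
`Cx_A_chart_u_lines`, `Cx_A_near`, `Cx_B_lineChart_X0`, `Cx_B_lineChart_X1`, `Cx_B_lineChart_X3`,
`Cx_B_lineChart_X0_noTop`, `Cx_B_lineChart_X1_noTop`, `five_not_mem`, `Cx_B_lineChart_X3_top`.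

[WRITER NOTE (decomp-res writer g13): file split only (tree files ≤ 400 lines, cut at declaration boundaries);
namespace, the section `RefCertificates` with its `open MvPolynomial` / `variable {K : Type*} [Field K]`, and every
declaration exactly as in the lens (the HOME-only dupNamespace-linter line is dropped — the library sets it;
`noncomputable section`, the file-level `open` lines, `universe u` and `open …Rescue.BedZpeBinom4Centre
(mul_mem_pow_add)` are replayed in every part).]

(Sources: Hironaka1967; CossartJannsenSaito2020 Def. 3.13 / Thm. 3.14, Ch. 8, Thm. 9.6; Hironaka1970;
CossartPiltant2019 Prop. 2.6; CossartPiltant2008 §2; Giraud1975; Hironaka2005; EGAIV4 §16–§18; StacksProject 0804 /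
0BIQ / 031I / 039P; Matsumura1987 §28–§30; Kollar2007 Thm. 1.101.)
-/

noncomputable section

open CategoryTheory CategoryTheory.Limits AlgebraicGeometry TopologicalSpace IsLocalRing
open Literature.AlgebraicGeometry.Resolution

universe u

open Summit.ResolutionOfSingularities.ResolutionOfSingularities.Theorems.Rescue.BedZpeBinom4Centre (mul_mem_pow_add)

namespace Summit.ResolutionOfSingularities.ResolutionOfSingularities.Theorems.DeltaCutClasses

open Summit.ResolutionOfSingularities.ResolutionOfSingularities.Theorems.TwistCutClasses
open Summit.ResolutionOfSingularities.ResolutionOfSingularities.Theorems.LightCutClasses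

section RefCertificates

open MvPolynomial
variable {K : Type*} [Field K]

/-- **chart `u` — THE TOP LOCUS of `g_u = z'³ + u·t'⁴ + u⁵·w'⁴` is `ℓ_u ∪ ũ`**: a prime of order `≥ 3` contains
`z'`, `t'`, and `u` or
`w'` (`∂_{t'}` then `∂_u`: `t'³`; `∂_{w'}`: `u⁵w'³`; `z'³`). [new; elementary] [folklore] -/
theorem Cx_A_chart_u_top [CharP K 3] (𝔮 : Ideal (MvPolynomial (Fin 4) K)) [𝔮.IsPrime] {s : MvPolynomial (Fin 4) K} (hs : s ∉ 𝔮)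
    (h : s * (X 0 ^ 3 + X 2 * X 1 ^ 4 + X 2 ^ 5 * X 3 ^ 4 : MvPolynomial (Fin 4) K) ∈ 𝔮 ^ 3) :
    (X 0 : MvPolynomial (Fin 4) K) ∈ 𝔮 ∧ (X 1 : MvPolynomial (Fin 4) K) ∈ 𝔮 ∧
      ((X 2 : MvPolynomial (Fin 4) K) ∈ 𝔮 ∨ (X 3 : MvPolynomial (Fin 4) K) ∈ 𝔮) := by
  have hs2 : s ^ 2 ∉ 𝔮 := pow_not_mem 𝔮 hs 2
  have hs4 : (s ^ 2) ^ 2 ∉ 𝔮 := pow_not_mem 𝔮 hs2 2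
  have h4 : (4 : MvPolynomial (Fin 4) K) ∉ 𝔮 := by
    have := natCast_not_mem (K := K) 𝔮 (m := 4) (by decide)
    exact_mod_cast this
  have e10 := f_ne K (i := 1) (j := 0) (by decide)
  have e12 := f_ne K (i := 1) (j := 2) (by decide)
  have e13 := f_ne K (i := 1) (j := 3) (by decide)
  have e20 := f_ne K (i := 2) (j := 0) (by decide)
  have e21 := f_ne K (i := 2) (j := 1) (by decide)
  have e23 := f_ne K (i := 2) (j := 3) (by decide)
  have e30 := f_ne K (i := 3) (j := 0) (by decide)
  have e31 := f_ne K (i := 3) (j := 1) (by decide)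
  have e32 := f_ne K (i := 3) (j := 2) (by decide)
  have e11 := f_self K 1
  have e22 := f_self K 2
  have e33 := f_self K 3
  have d1 : pderiv 1 (X 0 ^ 3 + X 2 * X 1 ^ 4 + X 2 ^ 5 * X 3 ^ 4 : MvPolynomial (Fin 4) K) = 4 * (X 2 * X 1 ^ 3) := by
    simp only [map_add, Derivation.leibniz, Derivation.leibniz_pow, smul_eq_mul, nsmul_eq_mul, e10, e11, e12, e13]
    push_cast; ring
  have d12 : pderiv 2 (4 * (X 2 * X 1 ^ 3) : MvPolynomial (Fin 4) K) = 4 * X 1 ^ 3 := by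
    have f4 : pderiv 2 (4 : MvPolynomial (Fin 4) K) = 0 := by
      have := (pderiv 2 : Derivation K (MvPolynomial (Fin 4) K) _).map_natCast 4
      exact_mod_cast this
    simp only [Derivation.leibniz, Derivation.leibniz_pow, smul_eq_mul, nsmul_eq_mul, e21, e22, f4]
    push_cast; ring
  have d3 : pderiv 3 (X 0 ^ 3 + X 2 * X 1 ^ 4 + X 2 ^ 5 * X 3 ^ 4 : MvPolynomial (Fin 4) K) = 4 * (X 2 ^ 5 * X 3 ^ 3) := by
    simp only [map_add, Derivation.leibniz, Derivation.leibniz_pow, smul_eq_mul, nsmul_eq_mul, e30, e31, e32, e33]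
    push_cast; ring
  have hX1 : (X 1 : MvPolynomial (Fin 4) K) ∈ 𝔮 := by
    have h1 := sq_mul_deriv_mem_pow 𝔮 h (pderiv 1)
    rw [d1] at h1
    have h12 := sq_mul_deriv_mem_pow 𝔮 h1 (pderiv 2)
    rw [d12, pow_one] at h12
    have : (X 1 ^ 3 : MvPolynomial (Fin 4) K) ∈ 𝔮 := by
      rcases ‹𝔮.IsPrime›.mem_or_mem h12 with h' | h'
      · exact absurd h' hs4
      rcases ‹𝔮.IsPrime›.mem_or_mem h' with h'' | h''
      · exact absurd h'' h4
      · exact h''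
    exact ‹𝔮.IsPrime›.mem_of_pow_mem 3 this
  have hX23 : (X 2 : MvPolynomial (Fin 4) K) ∈ 𝔮 ∨ (X 3 : MvPolynomial (Fin 4) K) ∈ 𝔮 := by
    have h3 := sq_mul_deriv_mem_pow 𝔮 h (pderiv 3)
    rw [d3] at h3
    have h23 : (X 2 ^ 5 * X 3 ^ 3 : MvPolynomial (Fin 4) K) ∈ 𝔮 := by
      have := Ideal.pow_le_self two_ne_zero h3
      rcases ‹𝔮.IsPrime›.mem_or_mem this with h' | h'
      · exact absurd h' hs2
      rcases ‹𝔮.IsPrime›.mem_or_mem h' with h'' | h''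
      · exact absurd h'' h4
      · exact h''
    rcases ‹𝔮.IsPrime›.mem_or_mem h23 with h' | h'
    · exact Or.inl (‹𝔮.IsPrime›.mem_of_pow_mem 5 h')
    · exact Or.inr (‹𝔮.IsPrime›.mem_of_pow_mem 3 h')
  have hf : (X 0 ^ 3 + X 2 * X 1 ^ 4 + X 2 ^ 5 * X 3 ^ 4 : MvPolynomial (Fin 4) K) ∈ 𝔮 := mem_of_sMul_mem_cube 𝔮 hs h
  have h25 : (X 2 ^ 5 * X 3 ^ 4 : MvPolynomial (Fin 4) K) ∈ 𝔮 := by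
    rcases hX23 with h' | h'
    · exact Ideal.mul_mem_right _ _ (Ideal.pow_mem_of_mem 𝔮 h' 5 (by norm_num))
    · exact Ideal.mul_mem_left _ _ (Ideal.pow_mem_of_mem 𝔮 h' 4 (by norm_num))
  have hX0 : (X 0 : MvPolynomial (Fin 4) K) ∈ 𝔮 := by
    refine ‹𝔮.IsPrime›.mem_of_pow_mem 3 ?_
    have := Ideal.sub_mem _ (Ideal.sub_mem _ hf (Ideal.mul_mem_left _ (X 2) (Ideal.pow_mem_of_mem 𝔮 hX1 4 (by norm_num)))) h25
    rwa [show (X 0 ^ 3 + X 2 * X 1 ^ 4 + X 2 ^ 5 * X 3 ^ 4 - X 2 * X 1 ^ 4 - X 2 ^ 5 * X 3 ^ 4 : MvPolynomial (Fin 4) K) = X 0 ^ 3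
      by ring] at this
  exact ⟨hX0, hX1, hX23⟩

/-- **chart `u` — BOTH LINES `ℓ_u = V(z',t',u)` (exceptional) and `ũ = V(z',t',w')` (= `C̃ ∩` chart, the strict transform of the
`u`-axis) lie in the top locus, are LINES, and are WILD everywhere**: `g_u ∈ P_ℓ³ ∩ P_ũ³`, `w' ∉ P_ℓ`, `u ∉ P_ũ`,
`g_u = z'³ + r` with
`r = u t'⁴ + u⁵ w'⁴ ∈ P_ℓ⁵ ∩ P_ũ⁴` (`3`-power form at every point of either line); they meet only at the chart origin `O_u`
(`P_ℓ ⊔ P_ũ = 𝔫₀`: `Cx_sing_closure` with `2 ↔ 3`) and `P_ℓ ⊓ P_ũ` is the NON-PRIME ideal of `Cx_closure_not_prime`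
— closure bad₁ is NOT
regular at `O_u` (the memoryless rule's dead end). [new; elementary] [folklore] -/
theorem Cx_A_chart_u_lines :
    ((X 0 ^ 3 + X 2 * X 1 ^ 4 + X 2 ^ 5 * X 3 ^ 4 : MvPolynomial (Fin 4) K) ∈ (Ideal.span {(X 0 : MvPolynomial (Fin 4) K), X 1, X 2}) ^ 3 ∧
      (X 0 ^ 3 + X 2 * X 1 ^ 4 + X 2 ^ 5 * X 3 ^ 4 : MvPolynomial (Fin 4) K) ∈ (Ideal.span {(X 0 : MvPolynomial (Fin 4) K), X 1, X 3}) ^ 3) ∧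
      ((X 3 : MvPolynomial (Fin 4) K) ∉ Ideal.span {(X 0 : MvPolynomial (Fin 4) K), X 1, X 2} ∧
        (X 2 : MvPolynomial (Fin 4) K) ∉ Ideal.span {(X 0 : MvPolynomial (Fin 4) K), X 1, X 3}) ∧
      ((X 2 * X 1 ^ 4 + X 2 ^ 5 * X 3 ^ 4 : MvPolynomial (Fin 4) K) ∈ (Ideal.span {(X 0 : MvPolynomial (Fin 4) K), X 1, X 2}) ^ 5 ∧
        (X 2 * X 1 ^ 4 + X 2 ^ 5 * X 3 ^ 4 : MvPolynomial (Fin 4) K) ∈ (Ideal.span {(X 0 : MvPolynomial (Fin 4) K), X 1, X 3}) ^ 4) := by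
  have hl0 : (X 0 : MvPolynomial (Fin 4) K) ∈ Ideal.span {(X 0 : MvPolynomial (Fin 4) K), X 1, X 2} := Ideal.subset_span (by simp)
  have hl1 : (X 1 : MvPolynomial (Fin 4) K) ∈ Ideal.span {(X 0 : MvPolynomial (Fin 4) K), X 1, X 2} := Ideal.subset_span (by simp)
  have hl2 : (X 2 : MvPolynomial (Fin 4) K) ∈ Ideal.span {(X 0 : MvPolynomial (Fin 4) K), X 1, X 2} := Ideal.subset_span (by simp)
  have hu0 : (X 0 : MvPolynomial (Fin 4) K) ∈ Ideal.span {(X 0 : MvPolynomial (Fin 4) K), X 1, X 3} := Ideal.subset_span (by simp)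
  have hu1 : (X 1 : MvPolynomial (Fin 4) K) ∈ Ideal.span {(X 0 : MvPolynomial (Fin 4) K), X 1, X 3} := Ideal.subset_span (by simp)
  have hu3 : (X 3 : MvPolynomial (Fin 4) K) ∈ Ideal.span {(X 0 : MvPolynomial (Fin 4) K), X 1, X 3} := Ideal.subset_span (by simp)
  have hrl : (X 2 * X 1 ^ 4 + X 2 ^ 5 * X 3 ^ 4 : MvPolynomial (Fin 4) K) ∈ (Ideal.span {(X 0 : MvPolynomial (Fin 4) K), X 1, X 2}) ^ 5 :=
    Ideal.add_mem _ (mul_mem_pow_add (m := 1) (n := 4) (by rw [pow_one]; exact hl2) (Ideal.pow_mem_pow hl1 4))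
      (Ideal.mul_mem_right _ _ (Ideal.pow_mem_pow hl2 5))
  have hru : (X 2 * X 1 ^ 4 + X 2 ^ 5 * X 3 ^ 4 : MvPolynomial (Fin 4) K) ∈ (Ideal.span {(X 0 : MvPolynomial (Fin 4) K), X 1, X 3}) ^ 4 :=
    Ideal.add_mem _ (Ideal.mul_mem_left _ _ (Ideal.pow_mem_pow hu1 4)) (Ideal.mul_mem_left _ _ (Ideal.pow_mem_pow hu3 4))
  refine ⟨⟨?_, ?_⟩, ⟨?_, ?_⟩, hrl, hru⟩
  · rw [add_assoc]; exact Ideal.add_mem _ (Ideal.pow_mem_pow hl0 3) (Ideal.pow_le_pow_right (by norm_num) hrl)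
  · rw [add_assoc]; exact Ideal.add_mem _ (Ideal.pow_mem_pow hu0 3) (Ideal.pow_le_pow_right (by norm_num) hru)
  · refine not_mem_span_of_eval _ (fun i => if i = 3 then 1 else 0) ?_ (by simp)
    intro g hg
    simp only [Set.mem_insert_iff, Set.mem_singleton_iff] at hg
    rcases hg with rfl | rfl | rfl <;> simp
  · refine not_mem_span_of_eval _ (fun i => if i = 2 then 1 else 0) ?_ (by simp)
    intro g hg
    simp only [Set.mem_insert_iff, Set.mem_singleton_iff] at hg
    rcases hg with rfl | rfl | rfl <;> simp

/-- **chart `u` — NEAR POINTS over EVERY point of `ℓ_u` and of `ũ`** (level-generic): over `(0,0,0,c) ∈ ℓ_u` (parameters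
`z', t', u, W = w' − c`; point chart `t'`: `z' = αT, u = βT, W = γT`) the transform is `α³ + β·T²·E` (`E = 1 + β⁴(c
+ γT)⁴`), and over
`(0,0,a,0) ∈ ũ`, `a ≠ 0` (point chart `U = u − a`) it is `α³ + U·E·(τ⁴ + H·γ⁴)` (`E = a + U`, `H = E⁴`): both lie in
`𝔫'³` for EVERY
cofactor — every point of `ℓ_u ∪ ũ` is WILD (previous lemma) and δ-HEAVY: bad₁ ⊇ all closed points of `ℓ_u ∪ ũ`.
[new; elementary]
[folklore] -/
theorem Cx_A_near :
    (∀ E : MvPolynomial (Fin 4) K, (X 0 ^ 3 + X 2 * X 1 ^ 2 * E : MvPolynomial (Fin 4) K) ∈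
        (Ideal.span {(X 0 : MvPolynomial (Fin 4) K), X 1, X 2, X 3}) ^ 3) ∧
      ∀ E H : MvPolynomial (Fin 4) K, (X 0 ^ 3 + X 2 * E * (X 1 ^ 4 + H * X 3 ^ 4) : MvPolynomial (Fin 4) K) ∈
        (Ideal.span {(X 0 : MvPolynomial (Fin 4) K), X 1, X 2, X 3}) ^ 3 := by
  refine ⟨fun E => ?_, fun E H => ?_⟩
  · refine Ideal.add_mem _ (Ideal.pow_mem_pow (X_mem_spanX4 0) 3) ?_
    have h : (X 2 * X 1 ^ 2 : MvPolynomial (Fin 4) K) ∈ (Ideal.span {(X 0 : MvPolynomial (Fin 4) K), X 1, X 2, X 3}) ^ (1 + 2) :=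
      mul_mem_pow_add (by rw [pow_one]; exact X_mem_spanX4 2) (Ideal.pow_mem_pow (X_mem_spanX4 1) 2)
    exact Ideal.mul_mem_right _ _ h
  · refine Ideal.add_mem _ (Ideal.pow_mem_pow (X_mem_spanX4 0) 3) ?_
    have h14 : (X 1 ^ 4 + H * X 3 ^ 4 : MvPolynomial (Fin 4) K) ∈ (Ideal.span {(X 0 : MvPolynomial (Fin 4) K), X 1, X 2, X 3}) ^ 4 :=
      Ideal.add_mem _ (Ideal.pow_mem_pow (X_mem_spanX4 1) 4) (Ideal.mul_mem_left _ _ (Ideal.pow_mem_pow (X_mem_spanX4 3) 4))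
    exact Ideal.mul_mem_left _ _ (Ideal.pow_le_pow_right (by norm_num) h14)

/-! #### R1 → R2 — PRE-STEP B (the EXIT hop): the blow-up of `ũ = V(z', t', w')` in chart-`u` coordinates
(`linChartSubst {0,1,3}`) -/

/-- chart `z'`: `g_u(z', t''z', u, w''z') = z'³·(1 + z'·u·(t''⁴ + u⁴·w''⁴))`. [new; elementary] [folklore] -/
theorem Cx_B_lineChart_X0 :
    aeval (linChartSubst (K := K) {0, 1, 3} 0) (X 0 ^ 3 + X 2 * X 1 ^ 4 + X 2 ^ 5 * X 3 ^ 4 : MvPolynomial (Fin 4) K) =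
      X 0 ^ 3 * (1 + X 0 * X 2 * (X 1 ^ 4 + X 2 ^ 4 * X 3 ^ 4)) := by
  simp [linChartSubst]; ring

/-- chart `t'`: `g_u(a t', t', u, b t') = t'³·(a³ + t'·u·(1 + u⁴b⁴))`. [new; elementary] [folklore] -/
theorem Cx_B_lineChart_X1 :
    aeval (linChartSubst (K := K) {0, 1, 3} 1) (X 0 ^ 3 + X 2 * X 1 ^ 4 + X 2 ^ 5 * X 3 ^ 4 : MvPolynomial (Fin 4) K) =
      X 1 ^ 3 * (X 0 ^ 3 + X 1 * X 2 * (1 + X 2 ^ 4 * X 3 ^ 4)) := by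
  simp [linChartSubst]; ring

/-- chart `w'`: `g_u(a w', b w', u, w') = w'³·(a³ + u·w'·(b⁴ + u⁴))` =: `w'³·g₂`. [new; elementary] [folklore] -/
theorem Cx_B_lineChart_X3 :
    aeval (linChartSubst (K := K) {0, 1, 3} 3) (X 0 ^ 3 + X 2 * X 1 ^ 4 + X 2 ^ 5 * X 3 ^ 4 : MvPolynomial (Fin 4) K) =
      X 3 ^ 3 * (X 0 ^ 3 + X 2 * X 3 * (X 1 ^ 4 + X 2 ^ 4)) := by
  simp [linChartSubst]; ring

/-- **chart `z'` — NO top point**: `1 + z'u(t''⁴ + u⁴w''⁴)` (`∂_{t''}`, `∂_{w''}`, then `1 ∈ 𝔮`). [new; elementary]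
[folklore] -/
theorem Cx_B_lineChart_X0_noTop [CharP K 3] (𝔮 : Ideal (MvPolynomial (Fin 4) K)) [𝔮.IsPrime] {s : MvPolynomial (Fin 4) K}
    (hs : s ∉ 𝔮) (h : s * (1 + X 0 * X 2 * (X 1 ^ 4 + X 2 ^ 4 * X 3 ^ 4) : MvPolynomial (Fin 4) K) ∈ 𝔮 ^ 3) : False := by
  have hs2 : s ^ 2 ∉ 𝔮 := pow_not_mem 𝔮 hs 2
  have h4 : (4 : MvPolynomial (Fin 4) K) ∉ 𝔮 := by
    have := natCast_not_mem (K := K) 𝔮 (m := 4) (by decide)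
    exact_mod_cast this
  have e10 := f_ne K (i := 1) (j := 0) (by decide)
  have e12 := f_ne K (i := 1) (j := 2) (by decide)
  have e13 := f_ne K (i := 1) (j := 3) (by decide)
  have e30 := f_ne K (i := 3) (j := 0) (by decide)
  have e31 := f_ne K (i := 3) (j := 1) (by decide)
  have e32 := f_ne K (i := 3) (j := 2) (by decide)
  have e11 := f_self K 1
  have e33 := f_self K 3
  have d1 : pderiv 1 (1 + X 0 * X 2 * (X 1 ^ 4 + X 2 ^ 4 * X 3 ^ 4) : MvPolynomial (Fin 4) K) = 4 * (X 0 * X 2 * X 1 ^ 3) := by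
    simp only [map_add, Derivation.leibniz, Derivation.leibniz_pow, smul_eq_mul, nsmul_eq_mul, e10, e11, e12, e13, f_one]
    push_cast; ring
  have d3 : pderiv 3 (1 + X 0 * X 2 * (X 1 ^ 4 + X 2 ^ 4 * X 3 ^ 4) : MvPolynomial (Fin 4) K) = 4 * (X 0 * X 2 ^ 5 * X 3 ^ 3) := by
    simp only [map_add, Derivation.leibniz, Derivation.leibniz_pow, smul_eq_mul, nsmul_eq_mul, e30, e31, e32, e33, f_one]
    push_cast; ring
  have hf : (1 + X 0 * X 2 * (X 1 ^ 4 + X 2 ^ 4 * X 3 ^ 4) : MvPolynomial (Fin 4) K) ∈ 𝔮 := mem_of_sMul_mem_cube 𝔮 hs h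
  have mem4 : ∀ {x : MvPolynomial (Fin 4) K}, s ^ 2 * (4 * x) ∈ 𝔮 ^ 2 → x ∈ 𝔮 := fun hx => by
    have := Ideal.pow_le_self two_ne_zero hx
    rcases ‹𝔮.IsPrime›.mem_or_mem this with h' | h'
    · exact absurd h' hs2
    rcases ‹𝔮.IsPrime›.mem_or_mem h' with h'' | h''
    · exact absurd h'' h4
    · exact h''
  have key : (X 0 * X 2 * (X 1 ^ 4 + X 2 ^ 4 * X 3 ^ 4) : MvPolynomial (Fin 4) K) ∈ 𝔮 := by
    have h1 := sq_mul_deriv_mem_pow 𝔮 h (pderiv 1)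
    rw [d1] at h1
    have h021 : (X 0 * X 2 * X 1 ^ 3 : MvPolynomial (Fin 4) K) ∈ 𝔮 := mem4 h1
    rcases ‹𝔮.IsPrime›.mem_or_mem h021 with h02 | h1'
    · exact Ideal.mul_mem_right _ _ h02
    have hX1 : (X 1 : MvPolynomial (Fin 4) K) ∈ 𝔮 := ‹𝔮.IsPrime›.mem_of_pow_mem 3 h1'
    have h3 := sq_mul_deriv_mem_pow 𝔮 h (pderiv 3)
    rw [d3] at h3
    have h0253 : (X 0 * X 2 ^ 5 * X 3 ^ 3 : MvPolynomial (Fin 4) K) ∈ 𝔮 := mem4 h3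
    rcases ‹𝔮.IsPrime›.mem_or_mem h0253 with h025 | h3'
    · rcases ‹𝔮.IsPrime›.mem_or_mem h025 with h0 | h25
      · exact Ideal.mul_mem_right _ _ (Ideal.mul_mem_right _ _ h0)
      · exact Ideal.mul_mem_right _ _ (Ideal.mul_mem_left _ _ (‹𝔮.IsPrime›.mem_of_pow_mem 5 h25))
    · have hX3 : (X 3 : MvPolynomial (Fin 4) K) ∈ 𝔮 := ‹𝔮.IsPrime›.mem_of_pow_mem 3 h3'
      exact Ideal.mul_mem_left _ _ (Ideal.add_mem _ (Ideal.pow_mem_of_mem 𝔮 hX1 4 (by norm_num))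
        (Ideal.mul_mem_left _ _ (Ideal.pow_mem_of_mem 𝔮 hX3 4 (by norm_num))))
  have h1mem : (1 : MvPolynomial (Fin 4) K) ∈ 𝔮 := by
    have := Ideal.sub_mem _ hf key
    rwa [add_sub_cancel_right] at this
  exact one_not_mem_of_isPrime 𝔮 h1mem

/-- **chart `t'` — NO top point**: for `a³ + t'·k`, `k = u(1 + u⁴b⁴)`: `∂_{t'}` gives `s²·k ∈ 𝔮²`, then `∂_u`: `1 +
5u⁴b⁴ ∈ 𝔮` and
`∂_b`: `u⁵b³ ∈ 𝔮` ⟹ `1 ∈ 𝔮` (where `1 + u⁴b⁴ = 0`, `k` is a REGULAR PARAMETER and `t'k` has order `2`). [new;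
elementary] [folklore] -/
theorem Cx_B_lineChart_X1_noTop [CharP K 3] (𝔮 : Ideal (MvPolynomial (Fin 4) K)) [𝔮.IsPrime] {s : MvPolynomial (Fin 4) K}
    (hs : s ∉ 𝔮) (h : s * (X 0 ^ 3 + X 1 * X 2 * (1 + X 2 ^ 4 * X 3 ^ 4) : MvPolynomial (Fin 4) K) ∈ 𝔮 ^ 3) : False := by
  have hs2 : s ^ 2 ∉ 𝔮 := pow_not_mem 𝔮 hs 2
  have hs4 : (s ^ 2) ^ 2 ∉ 𝔮 := pow_not_mem 𝔮 hs2 2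
  have h4 : (4 : MvPolynomial (Fin 4) K) ∉ 𝔮 := by
    have := natCast_not_mem (K := K) 𝔮 (m := 4) (by decide)
    exact_mod_cast this
  have e10 := f_ne K (i := 1) (j := 0) (by decide)
  have e12 := f_ne K (i := 1) (j := 2) (by decide)
  have e13 := f_ne K (i := 1) (j := 3) (by decide)
  have e23 := f_ne K (i := 2) (j := 3) (by decide)
  have e32 := f_ne K (i := 3) (j := 2) (by decide)
  have e11 := f_self K 1
  have e22 := f_self K 2
  have e33 := f_self K 3
  have d1 : pderiv 1 (X 0 ^ 3 + X 1 * X 2 * (1 + X 2 ^ 4 * X 3 ^ 4) : MvPolynomial (Fin 4) K) = X 2 + X 2 ^ 5 * X 3 ^ 4 := by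
    simp only [map_add, Derivation.leibniz, Derivation.leibniz_pow, smul_eq_mul, nsmul_eq_mul, e10, e11, e12, e13, f_one]
    push_cast; ring
  have d12 : pderiv 2 (X 2 + X 2 ^ 5 * X 3 ^ 4 : MvPolynomial (Fin 4) K) = 1 + 5 * (X 2 ^ 4 * X 3 ^ 4) := by
    simp only [map_add, Derivation.leibniz, Derivation.leibniz_pow, smul_eq_mul, nsmul_eq_mul, e22, e23]
    push_cast; ring
  have d13 : pderiv 3 (X 2 + X 2 ^ 5 * X 3 ^ 4 : MvPolynomial (Fin 4) K) = 4 * (X 2 ^ 5 * X 3 ^ 3) := by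
    simp only [map_add, Derivation.leibniz, Derivation.leibniz_pow, smul_eq_mul, nsmul_eq_mul, e32, e33]
    push_cast; ring
  have h1 := sq_mul_deriv_mem_pow 𝔮 h (pderiv 1)
  rw [d1] at h1
  have h12 := sq_mul_deriv_mem_pow 𝔮 h1 (pderiv 2)
  rw [d12, pow_one] at h12
  have hA : (1 + 5 * (X 2 ^ 4 * X 3 ^ 4) : MvPolynomial (Fin 4) K) ∈ 𝔮 := (‹𝔮.IsPrime›.mem_or_mem h12).resolve_left hs4
  have h13 := sq_mul_deriv_mem_pow 𝔮 h1 (pderiv 3)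
  rw [d13, pow_one] at h13
  have hB : (X 2 ^ 5 * X 3 ^ 3 : MvPolynomial (Fin 4) K) ∈ 𝔮 := by
    rcases ‹𝔮.IsPrime›.mem_or_mem h13 with h' | h'
    · exact absurd h' hs4
    rcases ‹𝔮.IsPrime›.mem_or_mem h' with h'' | h''
    · exact absurd h'' h4
    · exact h''
  have hprod : (X 2 ^ 4 * X 3 ^ 4 : MvPolynomial (Fin 4) K) ∈ 𝔮 := by
    rcases ‹𝔮.IsPrime›.mem_or_mem hB with h' | h'
    · exact Ideal.mul_mem_right _ _ (Ideal.pow_mem_of_mem 𝔮 (‹𝔮.IsPrime›.mem_of_pow_mem 5 h') 4 (by norm_num))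
    · exact Ideal.mul_mem_left _ _ (Ideal.pow_mem_of_mem 𝔮 (‹𝔮.IsPrime›.mem_of_pow_mem 3 h') 4 (by norm_num))
  have h1mem : (1 : MvPolynomial (Fin 4) K) ∈ 𝔮 := by
    have := Ideal.sub_mem _ hA (Ideal.mul_mem_left _ 5 hprod)
    rwa [add_sub_cancel_right] at this
  exact one_not_mem_of_isPrime 𝔮 h1mem

/-- `5` is a unit in characteristic `3`. [elementary] [folklore] -/
theorem five_not_mem [CharP K 3] (𝔮 : Ideal (MvPolynomial (Fin 4) K)) [𝔮.IsPrime] : (5 : MvPolynomial (Fin 4) K) ∉ 𝔮 := by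
  have := natCast_not_mem (K := K) 𝔮 (m := 5) (by decide)
  exact_mod_cast this

/-- **chart `w'` — THE TOP LOCUS of `g₂ = a³ + u·w'·(b⁴ + u⁴)` is the line `m = V(a, b, u)`** (`w'` free): a prime
of order `≥ 3`
contains `a, b, u` (`∂_{w'}`: `s²·u(b⁴+u⁴) ∈ 𝔮²`; then `∂_b`: `b³u ∈ 𝔮` and `∂_u`: `b⁴ + 5u⁴ ∈ 𝔮` ⟹ `b, u ∈ 𝔮`;
`a³`). [new; elementary]
[folklore] -/
theorem Cx_B_lineChart_X3_top [CharP K 3] (𝔮 : Ideal (MvPolynomial (Fin 4) K)) [𝔮.IsPrime] {s : MvPolynomial (Fin 4) K}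
    (hs : s ∉ 𝔮) (h : s * (X 0 ^ 3 + X 2 * X 3 * (X 1 ^ 4 + X 2 ^ 4) : MvPolynomial (Fin 4) K) ∈ 𝔮 ^ 3) :
    (X 0 : MvPolynomial (Fin 4) K) ∈ 𝔮 ∧ (X 1 : MvPolynomial (Fin 4) K) ∈ 𝔮 ∧ (X 2 : MvPolynomial (Fin 4) K) ∈ 𝔮 := by
  have hs2 : s ^ 2 ∉ 𝔮 := pow_not_mem 𝔮 hs 2
  have hs4 : (s ^ 2) ^ 2 ∉ 𝔮 := pow_not_mem 𝔮 hs2 2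
  have h4 : (4 : MvPolynomial (Fin 4) K) ∉ 𝔮 := by
    have := natCast_not_mem (K := K) 𝔮 (m := 4) (by decide)
    exact_mod_cast this
  have h5 : (5 : MvPolynomial (Fin 4) K) ∉ 𝔮 := five_not_mem 𝔮
  have e12 := f_ne K (i := 1) (j := 2) (by decide)
  have e21 := f_ne K (i := 2) (j := 1) (by decide)
  have e30 := f_ne K (i := 3) (j := 0) (by decide)
  have e31 := f_ne K (i := 3) (j := 1) (by decide)
  have e32 := f_ne K (i := 3) (j := 2) (by decide)
  have e11 := f_self K 1
  have e22 := f_self K 2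
  have e33 := f_self K 3
  have d3 : pderiv 3 (X 0 ^ 3 + X 2 * X 3 * (X 1 ^ 4 + X 2 ^ 4) : MvPolynomial (Fin 4) K) = X 1 ^ 4 * X 2 + X 2 ^ 5 := by
    simp only [map_add, Derivation.leibniz, Derivation.leibniz_pow, smul_eq_mul, nsmul_eq_mul, e30, e31, e32, e33]
    push_cast; ring
  have d31 : pderiv 1 (X 1 ^ 4 * X 2 + X 2 ^ 5 : MvPolynomial (Fin 4) K) = 4 * (X 2 * X 1 ^ 3) := by
    simp only [map_add, Derivation.leibniz, Derivation.leibniz_pow, smul_eq_mul, nsmul_eq_mul, e11, e12]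
    push_cast; ring
  have d32 : pderiv 2 (X 1 ^ 4 * X 2 + X 2 ^ 5 : MvPolynomial (Fin 4) K) = X 1 ^ 4 + 5 * X 2 ^ 4 := by
    simp only [map_add, Derivation.leibniz, Derivation.leibniz_pow, smul_eq_mul, nsmul_eq_mul, e21, e22]
    push_cast; ring
  have h3 := sq_mul_deriv_mem_pow 𝔮 h (pderiv 3)
  rw [d3] at h3
  have h31 := sq_mul_deriv_mem_pow 𝔮 h3 (pderiv 1)
  rw [d31, pow_one] at h31
  have h32 := sq_mul_deriv_mem_pow 𝔮 h3 (pderiv 2)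
  rw [d32, pow_one] at h32
  have hA : (X 2 : MvPolynomial (Fin 4) K) ∈ 𝔮 ∨ (X 1 : MvPolynomial (Fin 4) K) ∈ 𝔮 := by
    rcases ‹𝔮.IsPrime›.mem_or_mem h31 with h' | h'
    · exact absurd h' hs4
    rcases ‹𝔮.IsPrime›.mem_or_mem h' with h'' | h''
    · exact absurd h'' h4
    rcases ‹𝔮.IsPrime›.mem_or_mem h'' with h2 | h1
    · exact Or.inl h2
    · exact Or.inr (‹𝔮.IsPrime›.mem_of_pow_mem 3 h1)
  have hB : (X 1 ^ 4 + 5 * X 2 ^ 4 : MvPolynomial (Fin 4) K) ∈ 𝔮 := (‹𝔮.IsPrime›.mem_or_mem h32).resolve_left hs4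
  have hX12 : (X 1 : MvPolynomial (Fin 4) K) ∈ 𝔮 ∧ (X 2 : MvPolynomial (Fin 4) K) ∈ 𝔮 := by
    rcases hA with h2 | h1
    · refine ⟨‹𝔮.IsPrime›.mem_of_pow_mem 4 ?_, h2⟩
      have := Ideal.sub_mem _ hB (Ideal.mul_mem_left _ 5 (Ideal.pow_mem_of_mem 𝔮 h2 4 (by norm_num)))
      rwa [add_sub_cancel_right] at this
    · refine ⟨h1, ‹𝔮.IsPrime›.mem_of_pow_mem 4 ?_⟩
      have h54 : (5 * X 2 ^ 4 : MvPolynomial (Fin 4) K) ∈ 𝔮 := by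
        have := Ideal.sub_mem _ hB (Ideal.pow_mem_of_mem 𝔮 h1 4 (by norm_num))
        rwa [add_sub_cancel_left] at this
      exact (‹𝔮.IsPrime›.mem_or_mem h54).resolve_left h5
  have hf : (X 0 ^ 3 + X 2 * X 3 * (X 1 ^ 4 + X 2 ^ 4) : MvPolynomial (Fin 4) K) ∈ 𝔮 := mem_of_sMul_mem_cube 𝔮 hs h
  have hX0 : (X 0 : MvPolynomial (Fin 4) K) ∈ 𝔮 := by
    refine ‹𝔮.IsPrime›.mem_of_pow_mem 3 ?_
    have := Ideal.sub_mem _ hf (Ideal.mul_mem_right (X 1 ^ 4 + X 2 ^ 4) _ (Ideal.mul_mem_right (X 3) _ hX12.2))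
    rwa [add_sub_cancel_right] at this
  exact ⟨hX0, hX12.1, hX12.2⟩

end RefCertificates

end Summit.ResolutionOfSingularities.ResolutionOfSingularities.Theorems.DeltaCutClasses
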